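import Mathlib.RingTheory.Valuation.Integral
import Literature.NumberTheory.GaloisRepresentations.LocalFieldFiniteExtension
import HarnessLib

/-!
# The integers of a finite extension of a non-archimedean local field are the integral closure

Proof-only companion (no new definitions) of `LocalFieldFiniteExtension.lean`, which equips a
finite extension `L` of a non-archimedean local field `K` (Mathlib `IsNonarchimedeanLocalField`)
with the extended absolute value `FiniteExtension.normedField K L` (the spectral norm), the
valuative relation `FiniteExtension.valuativeRel K L` and its topology, and proves that `L` is
again a non-archimedean local field whose valuation prolongs that of `K`.

Here we identify the RING OF INTEGERS of that valuation: for `y : L`,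

* `FiniteExtension.norm_le_one_iff_isIntegral` — `‖y‖ ≤ 1 ↔ y` is integral over `𝒪[K]`;
* `FiniteExtension.mem_integer_iff_isIntegral` — `y ∈ 𝒪[L] ↔ y` is integral over `𝒪[K]`, i.e.
  `FiniteExtension.integer_eq_integralClosure`: **`𝒪[L]` is the integral closure of `𝒪[K]` in
  `L`** (Serre, *Local Fields*, Ch. II §2, Prop. 3: "the ring of `w` is the integral closure of the
  ring of `v` in `L`"; Neukirch, *Algebraic Number Theory*, Ch. II (4.8) and its proof);
* `FiniteExtension.mem_integer_algebraMap_iff` — `𝒪[L] ∩ K = 𝒪[K]`;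
* `FiniteExtension.valuation_eq_one_iff_isIntegral_and_isIntegral_inv` — the units of `𝒪[L]` are
  the non-zero `y` such that `y` and `y⁻¹` are both integral over `𝒪[K]`.

The engine is the norm-free algebraic lemma `isIntegral_integer_iff_spectralNorm_le_one` (any
field `F` with an absolute value, any valuation `w` on `F` with the same closed unit ball, any
extension field `L`, any `x : L` algebraic over `F`): `x` is integral over `w.integer` iff its
spectral norm `|x|_sp = max ‖a_{n-k}‖^{1/k}` is `≤ 1`, iff the coefficients of its minimal
polynomial over `F` lie in `w.integer` — because `w.integer` is integrally closed with fraction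
field `F`, so the minimal polynomial over `F` of a `w.integer`-integral element has coefficients in
`w.integer` (Mathlib `minpoly.isIntegrallyClosed_eq_field_fractions'`,
`spectralValue_le_one_iff`).  This generalises the tree's
`mem_absIntegers_integer_iff_spectralNorm_le_one` (`LocalGaloisGroupHenselProofs.lean`, stated
for `L = AlgebraicClosure F`) to an arbitrary extension; the proof is the same.

Consumers: every "finite level" statement about an MLF `k` inside `k̄` (e.g. [AbsTopIII] Def 3.1,
Rmk 3.1.1 as typed over `integralClosure 𝒪[k] k̄` in
`Literature.AnabelianGeometry.AbsoluteAnabelian.MLFGaloisModel`) reduces through these lemmas to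
Mathlib's `IsNonarchimedeanLocalField` API on the finite extension `k(x)`.

## References
* J.-P. Serre, *Local Fields*, GTM 67 (1979), Ch. II §2, Prop. 3 (`SerreLocalFields1979`).
* J. Neukirch, *Algebraic Number Theory* (1999), Ch. II, Thm. (4.8) (`NeukirchANT1999`).
-/

noncomputable section

open ValuativeRel

namespace Literature.NumberTheory.GaloisRepresentations

/-! ### Integrality over a valuation ring versus the spectral norm (any algebraic element) -/

section Spectral

variable {F : Type*} [NontriviallyNormedField F] {Γ : Type*} [LinearOrderedCommGroupWithZero Γ]
  {w : Valuation F Γ} {L : Type*} [Field L] [Algebra F L]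

/-- **Integral elements are the closed unit ball of the spectral norm.**  Let `‖·‖` be an absolute
value on the field `F`, `w` a valuation on `F` with the same closed unit ball
(`w a ≤ 1 ↔ ‖a‖ ≤ 1`), `L ⊇ F` an extension field and `x : L` algebraic over `F`.  Then `x` is
integral over the valuation ring `w.integer` iff its spectral norm
`|x|_sp = max_k ‖a_{n-k}‖^{1/k}` (`a_i` the coefficients of the minimal polynomial of `x` over `F`)
is `≤ 1`.  (`⇒`: `w.integer` is integrally closed with fraction field `F`, so the minimal polynomial
over `F` is the one over `w.integer`; `⇐`: all `‖a_i‖ ≤ 1`, so the minimal polynomial lifts to a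
monic polynomial over `w.integer`.)
Ref: Serre, *Local Fields*, Ch. II §2, Prop. 3; Neukirch, *ANT*, Ch. II (4.8).
[cite: SerreLocalFields1979, Ch. II §2 Prop. 3] -/
theorem isIntegral_integer_iff_spectralNorm_le_one (hw : ∀ a : F, w a ≤ 1 ↔ ‖a‖ ≤ 1) {x : L}
    (hx : IsIntegral F x) : IsIntegral w.integer x ↔ spectralNorm F L x ≤ 1 := by
  constructor
  · intro hxw
    rw [spectralNorm, minpoly.isIntegrallyClosed_eq_field_fractions' F hxw,
      spectralValue_le_one_iff ((minpoly.monic hxw).map _)]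
    intro n
    rw [Polynomial.coeff_map]
    exact (hw _).mp ((minpoly w.integer x).coeff n).2
  · intro hxn
    rw [spectralNorm, spectralValue_le_one_iff (minpoly.monic hx)] at hxn
    have hlifts : minpoly F x ∈ Polynomial.lifts (algebraMap w.integer F) := by
      rw [Polynomial.lifts_iff_coeff_lifts]
      intro n
      exact ⟨⟨(minpoly F x).coeff n, (hw _).mpr (hxn n)⟩, rfl⟩
    obtain ⟨q, hq, -, hqm⟩ :=
      Polynomial.lifts_and_natDegree_eq_and_monic hlifts (minpoly.monic hx)
    refine ⟨q, hqm, ?_⟩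
    have : Polynomial.aeval x (q.map (algebraMap w.integer F)) = 0 := by
      rw [hq, minpoly.aeval]
    rwa [Polynomial.aeval_map_algebraMap, Polynomial.aeval_def] at this

/-- Coefficient form of `isIntegral_integer_iff_spectralNorm_le_one`: an element `x` algebraic over
`F` is integral over the valuation ring `w.integer` iff every coefficient of its minimal polynomial
over `F` lies in `w.integer`.
Ref: Neukirch, *ANT*, Ch. II (4.8), proof ("`f` has coefficients in the valuation ring").
[cite: NeukirchANT1999, Ch. II (4.8)] -/
theorem isIntegral_integer_iff_forall_coeff_minpoly_mem (hw : ∀ a : F, w a ≤ 1 ↔ ‖a‖ ≤ 1) {x : L}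
    (hx : IsIntegral F x) : IsIntegral w.integer x ↔ ∀ n : ℕ, (minpoly F x).coeff n ∈ w.integer := by
  rw [isIntegral_integer_iff_spectralNorm_le_one hw hx, spectralNorm,
    spectralValue_le_one_iff (minpoly.monic hx)]
  refine forall_congr' fun n => ?_
  rw [Valuation.mem_integer_iff, hw]

end Spectral

/-! ### The ring of integers of a finite extension of a local field -/

namespace FiniteExtension

open IsNonarchimedeanLocalField

variable (K : Type*) [Field K] [ValuativeRel K] [TopologicalSpace K] [IsNonarchimedeanLocalField K]
  (L : Type*) [Field L] [Algebra K L] [FiniteDimensional K L]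

/-- For the extended absolute value of a finite extension `L/K` of a non-archimedean local field:
`‖y‖ ≤ 1` iff `y` is integral over `𝒪[K]`.
Ref: Serre, *Local Fields*, Ch. II §2, Prop. 3. [cite: SerreLocalFields1979, Ch. II §2 Prop. 3] -/
theorem norm_le_one_iff_isIntegral (y : L) :
    @Norm.norm L (normedField K L).toNorm y ≤ 1 ↔ IsIntegral 𝒪[K] y := by
  letI := nontriviallyNormedField K
  rw [norm_def]
  exact (isIntegral_integer_iff_spectralNorm_le_one (w := valuation K) (L := L)
    (valuation_le_one_iff_norm_le_one (F := K)) (Algebra.IsIntegral.isIntegral y)).symm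

/-- Unfolding lemma: for the valuation of a finite extension, `y ∈ 𝒪[L] ↔ ‖y‖ ≤ 1` (the ring of
the prolonged valuation `w` is the closed unit ball of the extended absolute value).
Ref: Serre, *Local Fields*, Ch. II §2, Prop. 3. [cite: SerreLocalFields1979, Ch. II §2 Prop. 3] -/
theorem mem_integer_iff_norm_le_one (y : L) :
    letI := valuativeRel K L
    y ∈ 𝒪[L] ↔ @Norm.norm L (normedField K L).toNorm y ≤ 1 := by
  letI := normedField K L
  letI := valuativeRel K L
  have h1 : y ∈ 𝒪[L] ↔ y ≤ᵥ (1 : L) := by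
    rw [Valuation.mem_integer_iff, (Valuation.Compatible.vle_iff_le (v := valuation L)), map_one]
  rw [h1, vle_iff_norm_le]
  change ‖y‖ ≤ ‖(1 : L)‖ ↔ ‖y‖ ≤ 1
  rw [norm_one]

/-- **The ring of integers of a finite extension is the integral closure** (membership form): for
a finite extension `L/K` of a non-archimedean local field with its extended valuation,
`y ∈ 𝒪[L]` iff `y` is integral over `𝒪[K]`.
Ref: Serre, *Local Fields*, Ch. II §2, Prop. 3 ("the ring of `w` is the integral closure of the
ring `A` of `v` in `L`"); Neukirch, *ANT*, Ch. II (4.8).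
[cite: SerreLocalFields1979, Ch. II §2 Prop. 3] -/
theorem mem_integer_iff_isIntegral (y : L) :
    letI := valuativeRel K L
    y ∈ 𝒪[L] ↔ IsIntegral 𝒪[K] y := by
  rw [mem_integer_iff_norm_le_one, norm_le_one_iff_isIntegral]

/-- **The ring of integers of a finite extension is the integral closure** (`Subring` form):
`𝒪[L] = integralClosure 𝒪[K] L`.
Ref: Serre, *Local Fields*, Ch. II §2, Prop. 3. [cite: SerreLocalFields1979, Ch. II §2 Prop. 3] -/
theorem integer_eq_integralClosure :
    letI := valuativeRel K L
    (𝒪[L] : Subring L) = (integralClosure 𝒪[K] L).toSubring := by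
  letI := valuativeRel K L
  ext y
  rw [mem_integer_iff_isIntegral, Subalgebra.mem_toSubring, mem_integralClosure_iff]

/-- `𝒪[L] ∩ K = 𝒪[K]`: an element of `K` is an integer of `L` iff it is an integer of `K` (the
valuation of `L` prolongs that of `K`).
Ref: Serre, *Local Fields*, Ch. II §2, Cor. 2. [cite: SerreLocalFields1979, Ch. II §2 Cor. 2] -/
theorem mem_integer_algebraMap_iff (x : K) :
    letI := valuativeRel K L
    algebraMap K L x ∈ 𝒪[L] ↔ x ∈ 𝒪[K] := by
  rw [mem_integer_iff_norm_le_one, norm_algebraMap]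
  letI := nontriviallyNormedField K
  exact IsNonarchimedeanLocalField.norm_le_one_iff K x

/-- Integers of `K` are integers of `L` (the valuation of `L` prolongs that of `K`).
Ref: Serre, *Local Fields*, Ch. II §2, Cor. 2. [cite: SerreLocalFields1979, Ch. II §2 Cor. 2] -/
theorem algebraMap_mem_integer (x : 𝒪[K]) :
    letI := valuativeRel K L
    algebraMap K L (x : K) ∈ 𝒪[L] :=
  (mem_integer_algebraMap_iff K L (x : K)).mpr x.2

/-- A non-zero `y : L` has valuation `1` (is a unit of the ring `𝒪[L]` of the prolonged valuation)
iff `y ∈ 𝒪[L]` and `y⁻¹ ∈ 𝒪[L]`.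
Ref: Serre, *Local Fields*, Ch. II §2, Prop. 3 (the ring of `w`); Ch. I §1 (units of a discrete
valuation ring are the elements of valuation `0`). [cite: SerreLocalFields1979, Ch. II §2 Prop. 3] -/
theorem valuation_eq_one_iff_mem_integer_and_inv_mem {y : L} (hy : y ≠ 0) :
    letI := valuativeRel K L
    valuation L y = 1 ↔ y ∈ 𝒪[L] ∧ y⁻¹ ∈ 𝒪[L] := by
  letI := valuativeRel K L
  rw [Valuation.mem_integer_iff, Valuation.mem_integer_iff, map_inv₀]
  have hpos : 0 < valuation L y := (Valuation.pos_iff _).mpr hy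
  constructor
  · intro h
    simp [h]
  · rintro ⟨h1, h2⟩
    exact le_antisymm h1 ((inv_le_one₀ hpos).mp h2)

/-- **Units of the ring of integers of a finite extension**: a non-zero `y : L` is a unit of
`𝒪[L]` (valuation `1`) iff both `y` and `y⁻¹` are integral over `𝒪[K]` — i.e.
`𝒪[L]^× = (integralClosure 𝒪[K] L)^×`.
Ref: Serre, *Local Fields*, Ch. II §2, Prop. 3. [cite: SerreLocalFields1979, Ch. II §2 Prop. 3] -/
theorem valuation_eq_one_iff_isIntegral_and_isIntegral_inv {y : L} (hy : y ≠ 0) :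
    letI := valuativeRel K L
    valuation L y = 1 ↔ IsIntegral 𝒪[K] y ∧ IsIntegral 𝒪[K] y⁻¹ := by
  rw [valuation_eq_one_iff_mem_integer_and_inv_mem K L hy, mem_integer_iff_isIntegral,
    mem_integer_iff_isIntegral]

end FiniteExtension

end Literature.NumberTheory.GaloisRepresentations

end
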